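import Summits.RiemannHypothesis.RiemannHypothesis.Theorems.JensenLogBandArcWindowCubic
import Summits.RiemannHypothesis.RiemannHypothesis.Theorems.JensenLogBandArcExpRep
import HarnessLib

/-!
# The window in Laplace form: `I(φ₀+ψ) = I(φ₀)·exp(−wψ² + E(ψ))`, `‖E(ψ)‖ ≤ 4n|ψ|³` (BAND line, S5-0)

RH ladder column JENSEN, rung J-P(P3) «log band», BAND crux `XiDerivBandRealAllRates` of route
«JensenLogBand», line «band-one-window» (u-arc reshape), lead rh-jensen-prover g7 — packaging of
S3/S4a/S4b into the exact input shape of `laplace_window_core` (p483889) for step (S5) of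
HOME/rh-jensen-prover/g7-work/LINE-PLAN.md §8.5. RH-FREE (Γ-factor only). WHAT THIS IS NOT:
nothing here bears on zeros of `ζ` or the truth of RH.

For the saddle `u*` (regime `|x| ≤ ½`, `T ≥ 100`, `ℓ_T ≥ 20`, `n ≥ 100`, `½ ≤ h ≤ (7/20)T`;
`r = ‖u*−c‖`, `φ₀ = arg(u*−c)`), put `w := S′(u*)(u*−c)²/2` (`Re w ≥ (11/40)n`, `‖w‖ ≤ (29/40)n`,
`descentDensity_saddle`) and `E(ψ) := ∫_{φ₀}^{φ₀+ψ} q + wψ²`. Then for `r|ψ| ≤ h/20`: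
* `window_admissible`: the arc between `φ₀` and `φ₀+ψ` is admissible (`Re(½+u) > 0`, …);
* `descentDensity1_saddle_eq`: `q′(φ₀) = −2w`;
* `window_exp_form`: `I(φ₀+ψ) = I(φ₀)·cexp(−wψ² + E(ψ))` and `‖E(ψ)‖ ≤ 4n|ψ|³`.
-/

noncomputable section

-- single-problem summit: `Summit.RiemannHypothesis.RiemannHypothesis.…` is the tree convention
set_option linter.dupNamespace false

open Complex Real Set MeasureTheory intervalIntegral

namespace Summit.RiemannHypothesis.RiemannHypothesis.Theorems.JensenPolynomials.LogBandArc

open Literature.NumberTheory.LFunctions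

variable {n : ℕ} {x T : ℝ} {ustar : ℂ}

/-- **The window arc is admissible and inside the disc.** [folklore] -/
theorem window_admissible (hx : |x| ≤ 1 / 2) (hT : 100 ≤ T) (hℓ : 20 ≤ ell T)
    (hn : 100 ≤ n) (hh : 1 / 2 ≤ bandRadius n T) (hhT : bandRadius n T ≤ 7 / 20 * T)
    (hustar : ‖ustar - ((x : ℂ) + (T : ℂ) * I + bandRadius n T)‖ ≤ 3 / 5 * bandRadius n T)
    (hS : arcSaddleFn n ((x : ℂ) + (T : ℂ) * I) ustar = 0) {t : ℝ}
    (ht : ‖ustar - ((x : ℂ) + (T : ℂ) * I)‖ * |t - Complex.arg (ustar - ((x : ℂ) + (T : ℂ) * I))| ≤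
      1 / 20 * bandRadius n T) :
    ‖circleMap ((x : ℂ) + (T : ℂ) * I) ‖ustar - ((x : ℂ) + (T : ℂ) * I)‖ t -
        ((x : ℂ) + (T : ℂ) * I + bandRadius n T)‖ ≤ 3 / 5 * bandRadius n T ∧
    0 < (1 / 2 + circleMap ((x : ℂ) + (T : ℂ) * I) ‖ustar - ((x : ℂ) + (T : ℂ) * I)‖ t).re ∧
    1 / 2 + circleMap ((x : ℂ) + (T : ℂ) * I) ‖ustar - ((x : ℂ) + (T : ℂ) * I)‖ t ≠ 1 ∧
    circleMap ((x : ℂ) + (T : ℂ) * I) ‖ustar - ((x : ℂ) + (T : ℂ) * I)‖ t ≠ 0 ∧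
    circleMap ((x : ℂ) + (T : ℂ) * I) ‖ustar - ((x : ℂ) + (T : ℂ) * I)‖ t + ((x : ℂ) + (T : ℂ) * I) ≠ 0 := by
  set h := bandRadius n T with hhdef
  set c : ℂ := (x : ℂ) + (T : ℂ) * I with hc
  set w : ℂ := ustar - c with hw
  set r : ℝ := ‖w‖ with hr
  set φ₀ : ℝ := Complex.arg w with hφ₀
  have hT0 : 0 < T := by linarith
  obtain ⟨hre_pos, -, -, -, -⟩ := arcSaddle_polar_bounds hx hT hℓ hn hh hhT hustar hS
  have hw0 : w ≠ 0 := by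
    intro h0
    have h' : (0 : ℝ) < w.re := hre_pos
    rw [h0] at h'; simp at h'
  have hr0 : 0 < r := norm_pos_iff.2 hw0
  have hstar : ‖ustar - (c + h)‖ ≤ 1 / 2 * h :=
    norm_arcSaddle_sub_center_le_half hx hT hℓ hn hh hhT hustar hS
  have hustar_eq : ustar = circleMap c r φ₀ := by
    rw [circleMap, hr, hφ₀, Complex.norm_mul_exp_arg_mul_I w, hw]; ring
  have hmem : ‖circleMap c r t - (c + h)‖ ≤ 3 / 5 * h := by
    have := circleMap_mem_disc_of_near_saddle (ψ := t - φ₀) hstar hustar_eq hr0.le (by linarith)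
    rwa [show φ₀ + (t - φ₀) = t by ring] at this
  obtain ⟨him_lo, -, hre_lo, -, -, -, hnu_lo, hucim, -, -⟩ := disc_geometry hx hT hh hhT hmem
  refine ⟨hmem, by linarith, ?_, ?_, ?_⟩
  · intro h0; have := congrArg Complex.im h0; simp at this
    have h' : 79 / 100 * T ≤ (1 / 2 + circleMap c r t).im := him_lo
    simp at h'; linarith
  · intro h0
    have h' : 79 / 100 * T ≤ ‖circleMap c r t‖ := hnu_lo
    rw [h0, norm_zero] at h'; linarith
  · intro h0; have := congrArg Complex.im h0; rw [Complex.zero_im] at this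
    have h' : 179 / 100 * T ≤ (circleMap c r t + c).im := hucim
    linarith

/-- **`q′(φ₀) = −S′(u*)(u*−c)²`** (so `w := S′(u*)(u*−c)²/2 = −q′(φ₀)/2`). [folklore] -/
theorem descentDensity1_saddle_eq (hx : |x| ≤ 1 / 2) (hT : 100 ≤ T) (hℓ : 20 ≤ ell T)
    (hn : 100 ≤ n) (hh : 1 / 2 ≤ bandRadius n T) (hhT : bandRadius n T ≤ 7 / 20 * T)
    (hustar : ‖ustar - ((x : ℂ) + (T : ℂ) * I + bandRadius n T)‖ ≤ 3 / 5 * bandRadius n T)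
    (hS : arcSaddleFn n ((x : ℂ) + (T : ℂ) * I) ustar = 0) :
    descentDensity1 n ((x : ℂ) + (T : ℂ) * I) ‖ustar - ((x : ℂ) + (T : ℂ) * I)‖
        (Complex.arg (ustar - ((x : ℂ) + (T : ℂ) * I))) =
      -(deriv (arcSaddleFn n ((x : ℂ) + (T : ℂ) * I)) ustar * (ustar - ((x : ℂ) + (T : ℂ) * I)) ^ 2) := by
  set h := bandRadius n T with hhdef
  set c : ℂ := (x : ℂ) + (T : ℂ) * I with hc
  set w : ℂ := ustar - c with hw
  set r : ℝ := ‖w‖ with hr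
  set φ₀ : ℝ := Complex.arg w with hφ₀
  have hustar_eq : ustar = circleMap c r φ₀ := by
    rw [circleMap, hr, hφ₀, Complex.norm_mul_exp_arg_mul_I w, hw]; ring
  have hderiv := (hasDerivAt_arcSaddleFn_eq hx hT hh hhT hustar).deriv
  rw [← hc] at hderiv
  have hn0 : (n : ℂ) ≠ 0 := by exact_mod_cast (show n ≠ 0 by omega)
  have hwc : ustar - c ≠ 0 := by
    obtain ⟨hre_pos, -, -, -, -⟩ := arcSaddle_polar_bounds hx hT hℓ hn hh hhT hustar hS
    intro h0
    have h' : (0 : ℝ) < (ustar - c).re := hre_pos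
    rw [h0] at h'; simp at h'
  -- `D(u*) = n/(u*−c)` from `S(u*) = 0`
  have hD : saddleDen n c ustar = (n : ℂ) / (ustar - c) := by
    have heq : ustar - c = (n : ℂ) / saddleDen n c ustar :=
      sub_eq_div_saddleDen_of_arcSaddleFn_eq_zero hx hT hℓ hn hh hhT hustar hS
    obtain ⟨hD0, -⟩ := norm_div_saddleDen_sub_le hx hT hℓ hn hh hhT hustar
    have hD0' : saddleDen n c ustar ≠ 0 := hD0
    rw [heq, div_div_eq_mul_div, mul_div_cancel_left₀ _ hn0]
  rw [descentDensity1, ← hustar_eq, hderiv, hD]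
  field_simp
  ring

/-- **The window in Laplace form.** With `w := S′(u*)(u*−c)²/2` and
`E(ψ) := ∫_{φ₀}^{φ₀+ψ} q + wψ²`: for `r|ψ| ≤ h/20`,
`I(φ₀+ψ) = I(φ₀)·cexp(−wψ² + E(ψ))` and `‖E(ψ)‖ ≤ 4n|ψ|³`. [folklore] -/
theorem window_exp_form (hx : |x| ≤ 1 / 2) (hT : 100 ≤ T) (hℓ : 20 ≤ ell T)
    (hn : 100 ≤ n) (hh : 1 / 2 ≤ bandRadius n T) (hhT : bandRadius n T ≤ 7 / 20 * T)
    (hustar : ‖ustar - ((x : ℂ) + (T : ℂ) * I + bandRadius n T)‖ ≤ 3 / 5 * bandRadius n T)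
    (hS : arcSaddleFn n ((x : ℂ) + (T : ℂ) * I) ustar = 0) {ψ : ℝ}
    (hψ : ‖ustar - ((x : ℂ) + (T : ℂ) * I)‖ * |ψ| ≤ 1 / 20 * bandRadius n T) :
    let c : ℂ := (x : ℂ) + (T : ℂ) * I
    let r : ℝ := ‖ustar - c‖
    let φ₀ : ℝ := Complex.arg (ustar - c)
    let w : ℂ := deriv (arcSaddleFn n c) ustar * (ustar - c) ^ 2 / 2
    let E : ℂ := (∫ t in φ₀..φ₀ + ψ, descentDensity n c r t) + w * (ψ : ℂ) ^ 2
    arcModelIntegrand n r c (φ₀ + ψ) = arcModelIntegrand n r c φ₀ * Complex.exp (-w * (ψ : ℂ) ^ 2 + E) ∧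
      ‖E‖ ≤ 4 * n * |ψ| ^ 3 := by
  intro c r φ₀ w E
  have hT0 : 0 < T := by linarith
  obtain ⟨hre_pos, -, -, -, -⟩ := arcSaddle_polar_bounds hx hT hℓ hn hh hhT hustar hS
  have hw0 : ustar - c ≠ 0 := by
    intro h0
    have h' : (0 : ℝ) < (ustar - c).re := hre_pos
    rw [h0] at h'; simp at h'
  have hr0 : 0 < r := norm_pos_iff.2 hw0
  -- admissibility along the window arc
  have hgood : ∀ t ∈ uIcc φ₀ (φ₀ + ψ), 0 < (1 / 2 + circleMap c r t).re ∧ 1 / 2 + circleMap c r t ≠ 1 ∧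
      circleMap c r t ≠ 0 ∧ circleMap c r t + c ≠ 0 := by
    intro t ht
    have h1 : |t - φ₀| ≤ |ψ| := by
      rcases le_total 0 ψ with hψ0 | hψ0
      · rw [uIcc_of_le (by linarith)] at ht
        rw [abs_of_nonneg (by linarith [ht.1]), abs_of_nonneg hψ0]; linarith [ht.2]
      · rw [uIcc_of_ge (by linarith)] at ht
        rw [abs_of_nonpos (by linarith [ht.2]), abs_of_nonpos hψ0]; linarith [ht.1]
    have ht' : r * |t - φ₀| ≤ 1 / 20 * bandRadius n T :=
      (mul_le_mul_of_nonneg_left h1 hr0.le).trans hψ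
    obtain ⟨-, h2, h3, h4, h5⟩ := window_admissible hx hT hℓ hn hh hhT hustar hS ht'
    exact ⟨h2, h3, h4, h5⟩
  have hexp := arcModelIntegrand_eq_mul_cexp_integral n hr0.ne' c hgood
  constructor
  · rw [hexp]
    congr 1
    congr 1
    show (∫ t in φ₀..φ₀ + ψ, descentDensity n c r t) = -w * (ψ : ℂ) ^ 2 + E
    ring
  · have hq1 := descentDensity1_saddle_eq hx hT hℓ hn hh hhT hustar hS
    have hcubic := window_cubic_remainder hx hT hℓ hn hh hhT hustar hS hψ
    have hE : E = (∫ t in φ₀..φ₀ + ψ, descentDensity n c r t) -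
        descentDensity1 n c r φ₀ / 2 * (ψ : ℂ) ^ 2 := by
      show (∫ t in φ₀..φ₀ + ψ, descentDensity n c r t) + w * (ψ : ℂ) ^ 2 = _
      rw [hq1]
      ring
    rw [hE]
    exact hcubic

end Summit.RiemannHypothesis.RiemannHypothesis.Theorems.JensenPolynomials.LogBandArc

end
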